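import Summits.CriticalPhenomena.CardyFormulaZ2.Theorems.CardyIKTransportIKMixedBoxCrossingStubMirrorBasics

/-!
# Mirror, part (e) infrastructure: disjoint coordinate restrictions are independent; upper ⊥ lower halves of the gauge rest; sections

Helper file of the line `paired-mirror-exploration` for the crux `IKMixedBoxCrossing` (stmt-CriticalPhenomena-5911, lead
prover-line-stmt-CriticalPhenomena-5911-0), toward the registered stub `stub_mirror : Mirror` (reflection positivity of the
column-mixed IK gauge in the cell row `0`, EVERY pattern `S`).  Vocabulary: `Theorems/CardyIKTransportIKMixedBoxCrossingDefs2.lean`.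
-/

noncomputable section

namespace Summit.CriticalPhenomena.CardyFormulaZ2.Cruxes.IKMixedBoxCrossing.PairedMirrorExploration

open scoped Classical
open MeasureTheory ProbabilityTheory Set
open Literature.Probability.Percolation Literature.Probability.LatticeModels
open Summit.CriticalPhenomena.CardyFormulaZ2.Theorems.IKLinearTransport.PinnedDiagramExchange
open Summit.CriticalPhenomena.CardyFormulaZ2.Theorems.IKQuarterTurn
  (measurePreserving_relabel measurePreserving_compl_int measurePreserving_complEquiv_site cnt mem_Ico_min_max
    xor_left_comm' xor_not_xor_not)

namespace IndepRestrict

open MeasureTheory ProbabilityTheory Set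
open Literature.Probability.Percolation

variable {V : Type*}

/-- Independence transfers along a push-forward: if `f ∘ h ⟂ g ∘ h` under `μ` then `f ⟂ g` under `μ.map h`. -/
theorem indepFun_map_of_comp {α β γ δ : Type*} [MeasurableSpace α] [MeasurableSpace β] [MeasurableSpace γ]
    [MeasurableSpace δ] {μ : Measure α} {h : α → β} (hh : Measurable h) {f : β → γ} {g : β → δ}
    (hf : Measurable f) (hg : Measurable g) (hind : IndepFun (f ∘ h) (g ∘ h) μ) :
    IndepFun f g (μ.map h) := by
  rw [indepFun_iff_measure_inter_preimage_eq_mul] at hind ⊢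
  intro s t hs ht
  rw [Measure.map_apply hh ((hf hs).inter (hg ht)), Measure.map_apply hh (hf hs), Measure.map_apply hh (hg ht)]
  exact hind s t hs ht

/-- The coordinates of `sitePi V p` are mutually independent σ-algebras. -/
theorem iIndep_coordSigma (p : unitInterval) : iIndep ((fun v : V => MeasurableSpace.comap (fun χ : V → Prop => χ v) inferInstance)) (sitePi V p) := by
  have h : iIndepFun (fun (v : V) (χ : V → Prop) => χ v) (sitePi V p) :=
    iIndepFun_infinitePi (P := fun _ : V => bernoulliProp p) (X := fun (_ : V) (x : Prop) => x)
      fun _ => measurable_id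
  exact (iIndepFun_iff_iIndep _ _ _).1 h

/-- Each coordinate σ-algebra is coarser than the product σ-algebra. -/
theorem coordSigma_le (v : V) :
    MeasurableSpace.comap (fun χ : V → Prop => χ v) inferInstance ≤ (inferInstance : MeasurableSpace (V → Prop)) :=
  (measurable_pi_apply v).comap_le

/-- The restricted configuration `χ ↦ {w | χ w} ∩ K` is measurable w.r.t. the coordinates in `K`. -/
theorem measurable_restrictSet (K : Set V) :
    Measurable[⨆ v ∈ K, MeasurableSpace.comap (fun χ : V → Prop => χ v) inferInstance] (fun χ : V → Prop => {w | χ w} ∩ K) := by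
  refine @measurable_set_iff _ _ (⨆ v ∈ K, MeasurableSpace.comap (fun χ : V → Prop => χ v) inferInstance) _ |>.2 fun w => ?_
  by_cases hw : w ∈ K
  · have h1 : Measurable[MeasurableSpace.comap (fun χ : V → Prop => χ w) inferInstance] (fun χ : V → Prop => χ w) :=
      Measurable.of_comap_le le_rfl
    have h2 : Measurable[⨆ v ∈ K, MeasurableSpace.comap (fun χ : V → Prop => χ v) inferInstance] (fun χ : V → Prop => χ w) :=
      h1.mono (le_iSup₂ (f := fun v (_ : v ∈ K) => MeasurableSpace.comap (fun χ : V → Prop => χ v) inferInstance) w hw) le_rfl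
    simpa [hw] using h2
  · simp only [mem_inter_iff, mem_setOf_eq, hw, and_false]
    exact measurable_const

/-- **Disjoint restrictions are independent** under `sitePercolation V p`. -/
theorem indepFun_inter_of_disjoint (p : unitInterval) {K₁ K₂ : Set V} (h : Disjoint K₁ K₂) :
    IndepFun (fun T : Set V => T ∩ K₁) (fun T => T ∩ K₂) (sitePercolation V p) := by
  have hmeas : ∀ K : Set V, Measurable fun T : Set V => T ∩ K := fun K =>
    measurable_set_iff.2 fun b => (measurable_set_mem b).and measurable_const
  rw [sitePercolation_eq_map]
  refine indepFun_map_of_comp measurable_setOf (hmeas K₁) (hmeas K₂) ?_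
  have hind := indep_iSup_of_disjoint (coordSigma_le (V := V)) (iIndep_coordSigma (V := V) p) h
  have hle₁ : MeasurableSpace.comap ((fun T : Set V => T ∩ K₁) ∘ fun χ : V → Prop => {w | χ w}) inferInstance ≤
      ⨆ v ∈ K₁, MeasurableSpace.comap (fun χ : V → Prop => χ v) inferInstance := (measurable_restrictSet K₁).comap_le
  have hle₂ : MeasurableSpace.comap ((fun T : Set V => T ∩ K₂) ∘ fun χ : V → Prop => {w | χ w}) inferInstance ≤
      ⨆ v ∈ K₂, MeasurableSpace.comap (fun χ : V → Prop => χ v) inferInstance := (measurable_restrictSet K₂).comap_le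
  exact indep_of_indep_of_le_right (indep_of_indep_of_le_left hind hle₁) hle₂


/-! ## Combining independent pairs on independent factors -/

section Combine

variable {Ω₁ Ω₂ X₁ X₂ Y₁ Y₂ : Type*} [MeasurableSpace Ω₁] [MeasurableSpace Ω₂] [MeasurableSpace X₁]
  [MeasurableSpace X₂] [MeasurableSpace Y₁] [MeasurableSpace Y₂]
  {μ₁ : Measure Ω₁} {μ₂ : Measure Ω₂} [IsProbabilityMeasure μ₁] [IsProbabilityMeasure μ₂]
  {u₁ : Ω₁ → X₁} {l₁ : Ω₁ → Y₁} {u₂ : Ω₂ → X₂} {l₂ : Ω₂ → Y₂}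

/-- The σ-algebra generated by a pair of maps is generated by intersections of preimages (a π-system). -/
theorem comap_prodMk_eq_generateFrom {Ω A B : Type*} [MeasurableSpace A] [MeasurableSpace B]
    (f : Ω → A) (g : Ω → B) :
    MeasurableSpace.comap (fun ω => (f ω, g ω)) Prod.instMeasurableSpace =
      MeasurableSpace.generateFrom {E | ∃ s t, MeasurableSet s ∧ MeasurableSet t ∧ E = f ⁻¹' s ∩ g ⁻¹' t} := by
  have hgen : (Prod.instMeasurableSpace : MeasurableSpace (A × B)) = MeasurableSpace.generateFrom
      (image2 (· ×ˢ ·) {s : Set A | MeasurableSet s} {t : Set B | MeasurableSet t}) := generateFrom_prod.symm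
  rw [hgen, MeasurableSpace.comap_generateFrom]
  congr 1
  ext E
  simp only [Set.mem_image, Set.mem_image2, Set.mem_setOf_eq]
  constructor
  · rintro ⟨R, ⟨s, hs, t, ht, rfl⟩, rfl⟩
    exact ⟨s, t, hs, ht, by ext ω; simp⟩
  · rintro ⟨s, t, hs, ht, rfl⟩
    exact ⟨s ×ˢ t, ⟨s, hs, t, ht, rfl⟩, by ext ω; simp⟩

/-- Intersections of preimages under a pair of maps form a π-system. -/
theorem isPiSystem_preimage_pair {Ω A B : Type*} [MeasurableSpace A] [MeasurableSpace B] (f : Ω → A) (g : Ω → B) :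
    IsPiSystem {E : Set Ω | ∃ s t, MeasurableSet s ∧ MeasurableSet t ∧ E = f ⁻¹' s ∩ g ⁻¹' t} := by
  rintro E ⟨s, t, hs, ht, rfl⟩ E' ⟨s', t', hs', ht', rfl⟩ -
  refine ⟨s ∩ s', t ∩ t', hs.inter hs', ht.inter ht', ?_⟩
  ext ω; simp only [Set.mem_inter_iff, Set.mem_preimage]; tauto

/-- **Independent pairs on independent factors combine**: if `u₁ ⟂ l₁` under `μ₁` and `u₂ ⟂ l₂` under `μ₂`,
then `(u₁ ∘ fst, u₂ ∘ snd) ⟂ (l₁ ∘ fst, l₂ ∘ snd)` under `μ₁.prod μ₂`. -/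
theorem indepFun_prod_pair (hu₁ : Measurable u₁) (hl₁ : Measurable l₁) (hu₂ : Measurable u₂) (hl₂ : Measurable l₂)
    (h₁ : IndepFun u₁ l₁ μ₁) (h₂ : IndepFun u₂ l₂ μ₂) :
    IndepFun (fun x : Ω₁ × Ω₂ => (u₁ x.1, u₂ x.2)) (fun x => (l₁ x.1, l₂ x.2)) (μ₁.prod μ₂) := by
  rw [indepFun_iff_measure_inter_preimage_eq_mul] at h₁ h₂
  -- independence of the generating π-systems
  have key : IndepSets {E | ∃ s t, MeasurableSet s ∧ MeasurableSet t ∧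
        E = (fun x : Ω₁ × Ω₂ => u₁ x.1) ⁻¹' s ∩ (fun x : Ω₁ × Ω₂ => u₂ x.2) ⁻¹' t}
      {E | ∃ s t, MeasurableSet s ∧ MeasurableSet t ∧
        E = (fun x : Ω₁ × Ω₂ => l₁ x.1) ⁻¹' s ∩ (fun x : Ω₁ × Ω₂ => l₂ x.2) ⁻¹' t} (μ₁.prod μ₂) := by
    rw [IndepSets_iff]
    rintro E F ⟨s, t, hs, ht, rfl⟩ ⟨s', t', hs', ht', rfl⟩
    have e1 : (fun x : Ω₁ × Ω₂ => u₁ x.1) ⁻¹' s ∩ (fun x : Ω₁ × Ω₂ => u₂ x.2) ⁻¹' t = (u₁ ⁻¹' s) ×ˢ (u₂ ⁻¹' t) := by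
      ext x; simp
    have e2 : (fun x : Ω₁ × Ω₂ => l₁ x.1) ⁻¹' s' ∩ (fun x : Ω₁ × Ω₂ => l₂ x.2) ⁻¹' t' = (l₁ ⁻¹' s') ×ˢ (l₂ ⁻¹' t') := by
      ext x; simp
    have e3 : (u₁ ⁻¹' s) ×ˢ (u₂ ⁻¹' t) ∩ (l₁ ⁻¹' s') ×ˢ (l₂ ⁻¹' t') =
        (u₁ ⁻¹' s ∩ l₁ ⁻¹' s') ×ˢ (u₂ ⁻¹' t ∩ l₂ ⁻¹' t') := Set.prod_inter_prod
    rw [e1, e2, e3, Measure.prod_prod, Measure.prod_prod, Measure.prod_prod, h₁ s s' hs hs', h₂ t t' ht ht']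
    ring
  have hind := IndepSets.indep' (μ := μ₁.prod μ₂) ?_ ?_ (isPiSystem_preimage_pair _ _) (isPiSystem_preimage_pair _ _) key
  · -- identify the generated σ-algebras with the comaps of the pair maps
    rw [IndepFun_iff_Indep, comap_prodMk_eq_generateFrom, comap_prodMk_eq_generateFrom]
    exact hind
  · rintro E ⟨s, t, hs, ht, rfl⟩
    exact ((hu₁.comp measurable_fst) hs).inter ((hu₂.comp measurable_snd) ht)
  · rintro E ⟨s, t, hs, ht, rfl⟩
    exact ((hl₁.comp measurable_fst) hs).inter ((hl₂.comp measurable_snd) ht)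

end Combine

end IndepRestrict

namespace MirrorRP

open scoped ENNReal
open ProbabilityTheory
open MirrorBasics IndepRestrict

/-- The gauge measure is (column signs) ⊗ (the rest). -/
theorem μIK_eq_prod : μIK = (sitePercolation ℤ half).prod νrest := rfl

/-- Intersection with a fixed set is measurable on set-valued configurations. -/
theorem measurable_inter_const {V : Type*} (K : Set V) : Measurable fun T : Set V => T ∩ K :=
  measurable_set_iff.2 fun b => (measurable_set_mem b).and measurable_const

/-- **Upper and lower coordinates of the rest are independent.** -/
theorem indepFun_upR_loR : IndepFun upR loR νrest := by
  have d1 : Disjoint UB LB := Set.disjoint_left.2 fun y (hy : 1 ≤ y) (hy' : y ≤ -1) => by omega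
  have d2 : Disjoint UF LF := Set.disjoint_left.2 fun f (hf : 0 ≤ f 1) (hf' : f 1 ≤ -1) => by omega
  have d3 : Disjoint UC LC := Set.disjoint_left.2 fun f (hf : 1 ≤ f 1) (hf' : f 1 ≤ -2) => by omega
  have h34 := indepFun_prod_pair (measurable_inter_const UF) (measurable_inter_const LF)
    (measurable_inter_const UC) (measurable_inter_const LC)
    (indepFun_inter_of_disjoint half d2) (indepFun_inter_of_disjoint half d3)
  have h234 := indepFun_prod_pair (measurable_inter_const UF) (measurable_inter_const LF)
    (((measurable_inter_const UF).comp measurable_fst).prodMk ((measurable_inter_const UC).comp measurable_snd) :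
      Measurable fun x : Set (Site 2) × Set (Site 2) => (x.1 ∩ UF, x.2 ∩ UC))
    (((measurable_inter_const LF).comp measurable_fst).prodMk ((measurable_inter_const LC).comp measurable_snd) :
      Measurable fun x : Set (Site 2) × Set (Site 2) => (x.1 ∩ LF, x.2 ∩ LC))
    (indepFun_inter_of_disjoint (Set.projIcc (0:ℝ) 1 zero_le_one (2 * Real.sqrt 3 - 3)) d2) h34
  have h := indepFun_prod_pair (measurable_inter_const UB) (measurable_inter_const LB)
    (((measurable_inter_const UF).comp measurable_fst).prodMk
      ((((measurable_inter_const UF).comp measurable_fst).prodMk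
        ((measurable_inter_const UC).comp measurable_snd)).comp measurable_snd) :
      Measurable fun x : Set (Site 2) × (Set (Site 2) × Set (Site 2)) => (x.1 ∩ UF, (x.2.1 ∩ UF, x.2.2 ∩ UC)))
    (((measurable_inter_const LF).comp measurable_fst).prodMk
      ((((measurable_inter_const LF).comp measurable_fst).prodMk
        ((measurable_inter_const LC).comp measurable_snd)).comp measurable_snd) :
      Measurable fun x : Set (Site 2) × (Set (Site 2) × Set (Site 2)) => (x.1 ∩ LF, (x.2.1 ∩ LF, x.2.2 ∩ LC)))
    (indepFun_inter_of_disjoint half d1) h234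
  exact h


/-! ### Upper/lower determinacy of sections -/

/-- The plaquette count in the rectangle to a cell of a row `≥ 1` reads only upper plaquettes. -/
theorem cnt_upper_congr (S : Set ℤ) (A : Set ℤ) (r : Rest) (a b : ℤ) (hb : 1 ≤ b) :
    cnt (parSet S ((A, upR r) : Ω)) a b = cnt (parSet S ((A, r) : Ω)) a b := by
  classical
  unfold cnt
  refine congrArg Finset.card (Finset.filter_congr fun f hf => ?_)
  rw [Finset.mem_product, mem_Ico_min_max, mem_Ico_min_max] at hf
  have h2 : 0 ≤ f.2 := by omega
  have hU : (![f.1, f.2] : Site 2) ∈ UF := by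
    show (0 : ℤ) ≤ (![f.1, f.2] : Site 2) 1; simpa using h2
  simp only [parSet, upR, Set.mem_setOf_eq, Set.mem_inter_iff, hU, and_true]

/-- Cells of rows `≥ 1` have the same colour for the rest and its upper restriction. -/
theorem mem_blackSet_upR (S : Set ℤ) (A : Set ℤ) (r : Rest) (v : Site 2) (hv : 1 ≤ v 1) :
    v ∈ blackSet S ((A, upR r) : Ω) ↔ v ∈ blackSet S ((A, r) : Ω) := by
  rw [mem_blackSet_iff_cnt, mem_blackSet_iff_cnt, cnt_upper_congr S A r _ _ hv]
  have hB : (v 1 ∈ r.1 ∩ UB) ↔ v 1 ∈ r.1 := ⟨fun h => h.1, fun h => ⟨h, hv⟩⟩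
  show Xor (v 0 ∈ A) (Xor (v 1 ∈ r.1 ∩ UB) _) ↔ Xor (v 0 ∈ A) (Xor (v 1 ∈ r.1) _)
  rw [hB]

/-- Faces of rows `≥ 1` have the same anti-diagonal flag for the rest and its upper restriction. -/
theorem mem_antiSet_upR (S : Set ℤ) (A : Set ℤ) (r : Rest) (f : Site 2) (hf : 1 ≤ f 1) :
    f ∈ antiSet S ((A, upR r) : Ω) ↔ f ∈ antiSet S ((A, r) : Ω) := by
  have hC : (f ∈ r.2.2.2 ∩ UC) ↔ f ∈ r.2.2.2 := ⟨fun h => h.1, fun h => ⟨h, hf⟩⟩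
  simp only [antiSet, upR, Set.mem_setOf_eq, hC]

/-- A section of an upper-determined event depends only on the upper coordinates of the rest. -/
theorem section_eq_preimage_upR (S : Set ℤ) {E : Set Obs} (hU : UpperDet E) (A : Set ℤ) :
    (Prod.mk A ⁻¹' (obs S ⁻¹' E) : Set Rest) = upR ⁻¹' (Prod.mk A ⁻¹' (obs S ⁻¹' E)) := by
  obtain ⟨Λ, hΛ, hdet⟩ := hU
  ext r
  simp only [Set.mem_preimage]
  refine (hdet (obs S ((A, r) : Ω)) (obs S ((A, upR r) : Ω)) fun v hv => ?_).symm.symm.trans ?_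
  · exact ⟨(mem_blackSet_upR S A r v (hΛ v hv)).symm, (mem_antiSet_upR S A r v (hΛ v hv)).symm⟩
  · exact Iff.rfl

/-- The upper part of the mirrored rest reads only the lower part of the rest. -/
theorem upR_θrest_loR (r : Rest) : upR (θrest (loR r)) = upR (θrest r) := by
  rw [θrest_apply, θrest_apply]
  simp only [upR, loR]
  refine Prod.ext ?_ (Prod.ext ?_ (Prod.ext ?_ ?_))
  · ext y
    simp only [Set.mem_inter_iff, SiteConfig.mem_relabel_iff, Equiv.neg_symm, Equiv.neg_apply, UB, LB, Set.mem_setOf_eq]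
    constructor
    · rintro ⟨⟨h1, -⟩, h3⟩; exact ⟨h1, h3⟩
    · rintro ⟨h1, h3⟩; exact ⟨⟨h1, by omega⟩, h3⟩
  · ext f
    simp only [Set.mem_inter_iff, SiteConfig.mem_relabel_iff, reflFace_symm, UF, LF, Set.mem_setOf_eq,
      reflFace_apply_one]
    constructor
    · rintro ⟨⟨h1, -⟩, h3⟩; exact ⟨h1, h3⟩
    · rintro ⟨h1, h3⟩; exact ⟨⟨h1, by omega⟩, h3⟩
  · ext f
    simp only [Set.mem_inter_iff, SiteConfig.mem_relabel_iff, reflFace_symm, UF, LF, Set.mem_setOf_eq,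
      reflFace_apply_one]
    constructor
    · rintro ⟨⟨h1, -⟩, h3⟩; exact ⟨h1, h3⟩
    · rintro ⟨h1, h3⟩; exact ⟨⟨h1, by omega⟩, h3⟩
  · ext f
    simp only [Set.mem_inter_iff, Set.mem_compl_iff, SiteConfig.mem_relabel_iff, reflFace_symm, UC, LC,
      Set.mem_setOf_eq, reflFace_apply_one, not_and, not_le]
    constructor
    · rintro ⟨h1, h3⟩; exact ⟨fun h => by have := h1 h; omega, h3⟩
    · rintro ⟨h1, h3⟩; exact ⟨fun h => (h1 h).elim, h3⟩


/-! ### The inequality -/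

/-- The lower part of the mirrored section reads only the lower coordinates. -/
theorem θrest_preimage_section_eq (S : Set ℤ) {E : Set Obs} (hU : UpperDet E) (A : Set ℤ) :
    (θrest ⁻¹' (Prod.mk A ⁻¹' (obs S ⁻¹' E)) : Set Rest) = loR ⁻¹' (θrest ⁻¹' (Prod.mk A ⁻¹' (obs S ⁻¹' E))) := by
  have h := section_eq_preimage_upR S hU A
  ext r
  constructor
  · intro hr
    have h1 : θrest r ∈ (upR ⁻¹' (Prod.mk A ⁻¹' (obs S ⁻¹' E)) : Set Rest) := h ▸ hr
    have h2 : θrest (loR r) ∈ (upR ⁻¹' (Prod.mk A ⁻¹' (obs S ⁻¹' E)) : Set Rest) := by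
      rw [Set.mem_preimage, upR_θrest_loR]; exact h1
    have h3 : θrest (loR r) ∈ (Prod.mk A ⁻¹' (obs S ⁻¹' E) : Set Rest) := h.symm ▸ h2
    exact h3
  · intro hr
    have h1 : θrest (loR r) ∈ (Prod.mk A ⁻¹' (obs S ⁻¹' E) : Set Rest) := hr
    have h2 : θrest (loR r) ∈ (upR ⁻¹' (Prod.mk A ⁻¹' (obs S ⁻¹' E)) : Set Rest) := h ▸ h1
    have h3 : θrest r ∈ (upR ⁻¹' (Prod.mk A ⁻¹' (obs S ⁻¹' E)) : Set Rest) := by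
      rw [Set.mem_preimage, ← upR_θrest_loR]; exact h2
    have h4 : θrest r ∈ (Prod.mk A ⁻¹' (obs S ⁻¹' E) : Set Rest) := h.symm ▸ h3
    exact h4

/-- `θrest` preserves `νrest`. -/
theorem measurePreserving_θrest_νrest : MeasurePreserving θrest νrest νrest := by
  unfold νrest; exact measurePreserving_θrest

/-- GIVEN THE COLUMN SIGNS, an upper-determined event and its mirror image are independent, and the mirror
image has the same conditional probability: `ν(G_A ∩ θ⁻¹ G_A) = ν(G_A)²`. -/
theorem νrest_section_inter_mirror (S : Set ℤ) {E : Set Obs} (hE : MeasurableSet E) (hU : UpperDet E) (A : Set ℤ) :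
    νrest ((Prod.mk A ⁻¹' (obs S ⁻¹' E)) ∩ θrest ⁻¹' (Prod.mk A ⁻¹' (obs S ⁻¹' E))) =
      νrest (Prod.mk A ⁻¹' (obs S ⁻¹' E)) * νrest (Prod.mk A ⁻¹' (obs S ⁻¹' E)) := by
  have hG : MeasurableSet (obs S ⁻¹' E) := (measurable_obs' S).2.2 hE
  have hGA : MeasurableSet (Prod.mk A ⁻¹' (obs S ⁻¹' E) : Set Rest) := measurable_prodMk_left hG
  have hθGA : MeasurableSet (θrest ⁻¹' (Prod.mk A ⁻¹' (obs S ⁻¹' E)) : Set Rest) := θrest.measurable hGA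
  have key := indepFun_upR_loR.measure_inter_preimage_eq_mul _ _ hGA hθGA
  rw [← section_eq_preimage_upR S hU A, ← θrest_preimage_section_eq S hU A] at key
  rw [key, measurePreserving_θrest_νrest.measure_preimage hGA.nullMeasurableSet]

end MirrorRP

/-- **Registered sub-goal `indepFun_upR_loR`**: under `νrest` the upper and the lower coordinates of the gauge rest are independent. -/
theorem indepFun_upR_loR : ProbabilityTheory.IndepFun upR loR νrest := MirrorRP.indepFun_upR_loR

end Summit.CriticalPhenomena.CardyFormulaZ2.Cruxes.IKMixedBoxCrossing.PairedMirrorExploration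

end
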